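import Summits.CriticalPhenomena.PercolationContinuityZ3.Theorems.PercNearOneGluingNoHeavyPcintClosingWordStructure
import HarnessLib

/-!
# CriticalPhenomena/PercolationContinuityZ3 — Theorems/PercNearOneGluingNoHeavyPcintClosingWordCount.lean: `fullClosingCount m (2m) = m!·2^m·a(m)` — the `2m`-gons spanning `m` axes are the labelled oriented IRREDUCIBLE CHORD DIAGRAMS (combinatorial core of STRUCTURE law C5-L1, part 6)

Lane prim-pcint, STRUCTURE rule «numerics ⇒ structure ⇒ conjecture» (prim-pcint-2 GEN 20); sequel of …PcintClosingWordStructure.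
Fix an irreducible chord diagram `π` on the `2m` points (letters `0..2m−2` and the closing point).  Its OPENERS (letters preceding their partner,
`openers π`) number `m` (`two_mul_card_openers`); a labelling of the openers by the `m` axes (an embedding, hence a bijection) and a choice of
signs (`(openers π ↪ Fin m) × (openers π → Bool)`, `m!·2^m` of them) determines the word `mkWord π e` (the partner of an opener carries the
reversed letter), which is compatible with `π` (`compat_mkWord`), hence self-avoiding (…ClosingWordDiagram), ends next to the origin and uses
every axis: `e ↦ mkWord π e` is a bijection onto the closing words compatible with `π` (`card_fibre`).  Conversely every extremal full closing
word is compatible with exactly one diagram (…ClosingWordStructure, `compat_unique`), which is irreducible.  Summing over `π`: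
**`fullClosingCount (k+1) (2(k+1)) = (k+1)!·2^(k+1)·#Irr(Fin (2k+2)) = (k+1)!·2^(k+1)·connChord (k+1)`** (`fullClosingCount_eq`).

HONEST FRAMING: elementary finite combinatorics written for the proof of `polygonLeadingCoeffLaw` (all `m`, next file).  No `sorry`; standard
axioms.  Written by prim-pcint-2 gen 20 (prover-prim-pcint-2-g20-0), 2026-08-26.
-/

noncomputable section

namespace Summit.CriticalPhenomena.PercolationContinuityZ3.Theorems.Pcint.ChordDiag

open scoped Nat
open Literature.Probability.LatticeModels Literature.Probability.Percolation
open Summit.CriticalPhenomena.PercolationContinuityZ3.Theorems.Pcint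
open Summit.CriticalPhenomena.PercolationContinuityZ3.Theorems.Pcint.MemoryTail

variable {K k j : ℕ}

/-! ### Openers -/

/-- The OPENERS of a diagram on `Fin (K+1)`: letters preceding their partner. [folklore] -/
def openers (π : Fin (K + 1) → Fin (K + 1)) : Finset (Fin K) := Finset.univ.filter fun s => Fin.castSucc s < π (Fin.castSucc s)

variable {π : Fin (K + 1) → Fin (K + 1)}

/-- Membership in `openers`. [folklore] -/
theorem mem_openers {s : Fin K} : s ∈ openers π ↔ Fin.castSucc s < π (Fin.castSucc s) := by
  simp [openers]

/-- A non-opener has a real partner, which is an opener. [folklore] -/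
theorem pre_of_not_mem (hd : IsDiag π) {s : Fin K} (hs : s ∉ openers π) :
    π (Fin.castSucc s) = Fin.castSucc (pre π s) ∧ pre π s ∈ openers π := by
  rw [mem_openers, not_lt] at hs
  have hlt : π (Fin.castSucc s) < Fin.castSucc s := lt_of_le_of_ne hs (hd _).2
  obtain ⟨t, ht⟩ := Fin.exists_castSucc_eq.2 (hlt.trans (Fin.castSucc_lt_last s)).ne
  rw [pre_eq_of ht.symm]
  refine ⟨ht.symm, mem_openers.2 ?_⟩
  rw [ht, (hd _).1]
  exact hlt

/-- The partner of an opener other than the lone letter is a real non-opener. [folklore] -/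
theorem pre_of_mem (hd : IsDiag π) {t : Fin K} (ht : t ∈ openers π) (htl : t ≠ lone hd) :
    π (Fin.castSucc t) = Fin.castSucc (pre π t) ∧ pre π t ∉ openers π := by
  have hne : π (Fin.castSucc t) ≠ Fin.last K := fun h => htl ((eq_last_iff hd t).1 h)
  obtain ⟨s, hs⟩ := Fin.exists_castSucc_eq.2 hne
  rw [pre_eq_of hs.symm]
  refine ⟨hs.symm, fun hso => ?_⟩
  have h1 := mem_openers.1 ht
  have h2 := mem_openers.1 hso
  rw [hs, (hd _).1] at h2
  exact lt_asymm h1 h2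

/-- The lone letter is an opener. [folklore] -/
theorem lone_mem_openers (hd : IsDiag π) : lone hd ∈ openers π := by
  rw [mem_openers, castSucc_lone, (hd _).1, ← castSucc_lone hd]
  exact Fin.castSucc_lt_last _

/-- **Half of the points are openers**: `2·#openers = K + 1`. [folklore] -/
theorem two_mul_card_openers (hd : IsDiag π) : 2 * (openers π).card = K + 1 := by
  classical
  have h1 : ((openers π).erase (lone hd)).card = (Finset.univ.filter fun s => s ∉ openers π).card := by
    refine Finset.card_nbij' (pre π) (pre π) ?_ ?_ ?_ ?_
    · intro t ht
      rw [Finset.mem_coe, Finset.mem_erase] at ht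
      rw [Finset.mem_coe, Finset.mem_filter]
      exact ⟨Finset.mem_univ _, (pre_of_mem hd ht.2 ht.1).2⟩
    · intro s hs
      rw [Finset.mem_coe, Finset.mem_filter] at hs
      obtain ⟨h1, h2⟩ := pre_of_not_mem hd hs.2
      rw [Finset.mem_coe, Finset.mem_erase]
      refine ⟨fun h => ?_, h2⟩
      have h3 : π (Fin.castSucc (pre π s)) = Fin.castSucc s := by rw [← h1, (hd _).1]
      rw [h, castSucc_lone, (hd _).1] at h3
      exact (Fin.castSucc_lt_last s).ne h3.symm
    · intro t ht
      rw [Finset.mem_coe, Finset.mem_erase] at ht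
      exact pre_eq_of (by rw [← (pre_of_mem hd ht.2 ht.1).1, (hd _).1])
    · intro s hs
      rw [Finset.mem_coe, Finset.mem_filter] at hs
      exact pre_eq_of (by rw [← (pre_of_not_mem hd hs.2).1, (hd _).1])
  have h2 := Finset.card_erase_add_one (lone_mem_openers hd)
  have h3 := Finset.card_filter_add_card_filter_not (s := (Finset.univ : Finset (Fin K))) (p := fun s => s ∈ openers π)
  rw [Finset.filter_mem_eq_inter, Finset.univ_inter, Finset.card_univ, Fintype.card_fin] at h3
  omega

/-! ### The word of a labelled oriented diagram -/

/-- The letter written at an opener (junk elsewhere). [folklore] -/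
def extE (π : Fin (K + 1) → Fin (K + 1)) (e : (↥(openers π) ↪ Fin (k + 1)) × (↥(openers π) → Bool)) (s : Fin K) :
    Fin (k + 1) × Bool :=
  if h : s ∈ openers π then (e.1 ⟨s, h⟩, e.2 ⟨s, h⟩) else (0, false)

/-- **The word of a labelled oriented diagram**: openers carry their label and sign, their partners the reversed letter. [folklore] -/
def mkWord (π : Fin (K + 1) → Fin (K + 1)) (e : (↥(openers π) ↪ Fin (k + 1)) × (↥(openers π) → Bool)) :
    Fin K → Fin (k + 1) × Bool :=
  fun s => if s ∈ openers π then extE π e s else srev (extE π e (pre π s))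

section MkWord

variable (e : (↥(openers π) ↪ Fin (k + 1)) × (↥(openers π) → Bool))

/-- `extE` at an opener. [folklore] -/
theorem extE_of_mem {s : Fin K} (h : s ∈ openers π) : extE π e s = (e.1 ⟨s, h⟩, e.2 ⟨s, h⟩) := by
  simp [extE, h]

/-- `extE` labels are injective on openers. [folklore] -/
theorem eq_of_extE_fst_eq {s t : Fin K} (hs : s ∈ openers π) (ht : t ∈ openers π) (h : (extE π e s).1 = (extE π e t).1) :
    s = t := by
  rw [extE_of_mem e hs, extE_of_mem e ht] at h
  exact congrArg Subtype.val (e.1.injective h)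

/-- `mkWord` at an opener. [folklore] -/
theorem mkWord_of_mem {s : Fin K} (h : s ∈ openers π) : mkWord π e s = extE π e s := if_pos h

/-- `mkWord` at a non-opener. [folklore] -/
theorem mkWord_of_not_mem {s : Fin K} (h : s ∉ openers π) : mkWord π e s = srev (extE π e (pre π s)) := if_neg h

/-- **The word of a labelled oriented diagram is compatible with the diagram.** [folklore] -/
theorem compat_mkWord (hd : IsDiag π) : Compat π (mkWord π e) := by
  constructor
  · intro s t hst
    by_cases hs : s ∈ openers π
    · have ht : t ∉ openers π := by
        rw [mem_openers, not_lt, ← hst, (hd _).1]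
        exact (mem_openers.1 hs).le
      have hpre : pre π t = s := pre_eq_of (by rw [← hst, (hd _).1])
      rw [mkWord_of_not_mem e ht, hpre, mkWord_of_mem e hs]
    · obtain ⟨-, h2⟩ := pre_of_not_mem hd hs
      have hpre : pre π s = t := pre_eq_of hst
      rw [hpre] at h2
      rw [mkWord_of_not_mem e hs, hpre, mkWord_of_mem e h2, srev_srev]
  · intro s t hst hax
    by_cases hs : s ∈ openers π <;> by_cases ht : t ∈ openers π
    · rw [mkWord_of_mem e hs, mkWord_of_mem e ht] at hax
      exact absurd (eq_of_extE_fst_eq e hs ht hax) hst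
    · obtain ⟨h1, h2⟩ := pre_of_not_mem hd ht
      rw [mkWord_of_mem e hs, mkWord_of_not_mem e ht] at hax
      have h3 : s = pre π t := eq_of_extE_fst_eq e hs h2 hax
      rw [← h3] at h1
      rw [← h1, (hd _).1]
    · obtain ⟨h1, h2⟩ := pre_of_not_mem hd hs
      rw [mkWord_of_not_mem e hs, mkWord_of_mem e ht] at hax
      have h3 : pre π s = t := eq_of_extE_fst_eq e h2 ht hax
      rw [h1, h3]
    · obtain ⟨h1, h2⟩ := pre_of_not_mem hd hs
      obtain ⟨h3, h4⟩ := pre_of_not_mem hd ht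
      rw [mkWord_of_not_mem e hs, mkWord_of_not_mem e ht] at hax
      have h5 : pre π s = pre π t := eq_of_extE_fst_eq e h2 h4 hax
      exfalso
      apply hst
      apply Fin.castSucc_injective
      apply hd.injective
      rw [h1, h3, h5]

end MkWord

/-! ### The fibre over a diagram -/

/-- The full closing words of length `K` on `k + 1` axes. [folklore] -/
def fullWords (K k : ℕ) : Finset (Fin K → Fin (k + 1) × Bool) :=
  (nearWords (k + 1) (K + 1) K).filter fun w => axes w = Finset.univ

/-- Membership in `fullWords`. [folklore] -/
theorem mem_fullWords {w : Fin K → Fin (k + 1) × Bool} :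
    w ∈ fullWords K k ↔ IsSAW w ∧ l1 (wordPos w K) ≤ 1 ∧ ∀ c, ∃ t, (w t).1 = c := by
  unfold fullWords
  rw [Finset.mem_filter, mem_nearWords, Nat.add_sub_cancel_left, and_assoc]
  refine and_congr_right fun _ => and_congr_right fun _ => ?_
  unfold axes
  rw [Finset.eq_univ_iff_forall]
  refine forall_congr' fun c => ?_
  rw [Finset.mem_image]
  exact ⟨fun ⟨t, _, ht⟩ => ⟨t, ht⟩, fun ⟨t, ht⟩ => ⟨t, Finset.mem_univ _, ht⟩⟩

/-- `fullClosingCount` counts `fullWords`. [folklore] -/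
theorem fullClosingCount_eq_card (K k : ℕ) : fullClosingCount (k + 1) (K + 1) = (fullWords K k).card := by
  unfold fullClosingCount fullWords
  rw [Nat.add_sub_cancel]

open Classical in
/-- The fibre over a diagram: the full closing words compatible with it. [folklore] -/
def fibre (k : ℕ) (π : Fin (K + 1) → Fin (K + 1)) : Finset (Fin K → Fin (k + 1) × Bool) :=
  (fullWords K k).filter fun w => Compat π w

/-- **The fibre over an irreducible diagram has `(k+1)!·2^(k+1)` words** (`K + 1 = 2(k+1)`). [folklore] -/
theorem card_fibre (hK : K + 1 = 2 * (k + 1)) (hg : IsGood π) : (fibre k π).card = (k + 1)! * 2 ^ (k + 1) := by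
  classical
  have hd := hg.1
  have hcard : (openers π).card = k + 1 := by have := two_mul_card_openers hd; omega
  -- the parameter space
  have hE : Fintype.card ((↥(openers π) ↪ Fin (k + 1)) × (↥(openers π) → Bool)) = (k + 1)! * 2 ^ (k + 1) := by
    rw [Fintype.card_prod, Fintype.card_embedding_eq, Fintype.card_fun, Fintype.card_bool, Fintype.card_coe, hcard,
      Fintype.card_fin, Nat.descFactorial_self]
  rw [← hE, ← Finset.card_univ]
  symm
  refine Finset.card_nbij (mkWord π) ?_ ?_ ?_
  · -- into the fibre
    intro e _
    rw [Finset.mem_coe, fibre, Finset.mem_filter, mem_fullWords]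
    have hc := compat_mkWord e hd
    refine ⟨⟨(isSAW_iff_isGood hd hc).2 hg, (l1_wordPos_length hd hc).le, fun c => ?_⟩, hc⟩
    have hbij : Function.Bijective e.1 :=
      (Fintype.bijective_iff_injective_and_card _).2 ⟨e.1.injective, by rw [Fintype.card_coe, hcard, Fintype.card_fin]⟩
    obtain ⟨⟨s, hs⟩, hsc⟩ := hbij.2 c
    exact ⟨s, by rw [mkWord_of_mem e hs, extE_of_mem e hs]; exact hsc⟩
  · -- injective
    intro e _ e' _ h
    have key : ∀ s (hs : s ∈ openers π), (e.1 ⟨s, hs⟩, e.2 ⟨s, hs⟩) = (e'.1 ⟨s, hs⟩, e'.2 ⟨s, hs⟩) := by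
      intro s hs
      rw [← extE_of_mem e hs, ← extE_of_mem e' hs, ← mkWord_of_mem e hs, ← mkWord_of_mem e' hs, h]
    refine Prod.ext (Function.Embedding.ext fun s => ?_) (funext fun s => ?_)
    · have := key s.1 s.2; simp only [Prod.mk.injEq] at this; exact this.1
    · have := key s.1 s.2; simp only [Prod.mk.injEq] at this; exact this.2
  · -- onto the fibre
    intro w hw
    rw [Finset.mem_coe, fibre, Finset.mem_filter] at hw
    obtain ⟨-, hc⟩ := hw
    -- the labelling read off `w`
    have hinj : Function.Injective fun s : ↥(openers π) => (w s.1).1 := by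
      rintro ⟨s, hs⟩ ⟨s', hs'⟩ h
      by_contra hne
      have hne' : s ≠ s' := fun h' => hne (Subtype.ext h')
      have h1 := hc.2 s s' hne' h
      have h2 := mem_openers.1 hs
      have h3 := mem_openers.1 hs'
      have h4 : π (Fin.castSucc s') = Fin.castSucc s := by rw [← h1, (hd _).1]
      rw [h1] at h2
      rw [h4] at h3
      exact lt_asymm h2 h3
    refine ⟨(⟨fun s => (w s.1).1, hinj⟩, fun s => (w s.1).2), Finset.mem_coe.2 (Finset.mem_univ _), ?_⟩
    funext s
    by_cases hs : s ∈ openers π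
    · rw [mkWord_of_mem _ hs, extE_of_mem _ hs]
      rfl
    · obtain ⟨h1, h2⟩ := pre_of_not_mem hd hs
      rw [mkWord_of_not_mem _ hs, extE_of_mem _ h2]
      have h3 : π (Fin.castSucc (pre π s)) = Fin.castSucc s := by rw [← h1, (hd _).1]
      rw [hc.1 _ _ h3]
      rfl

/-! ### Every extremal full closing word lies over exactly one diagram -/

/-- Two diagrams compatible with the same word coincide. [folklore] -/
theorem compat_unique {π π' : Fin (K + 1) → Fin (K + 1)} (hd : IsDiag π) (hd' : IsDiag π') {w : Fin K → Fin j × Bool}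
    (hc : Compat π w) (hc' : Compat π' w) : π = π' := by
  have key : ∀ s : Fin K, π (Fin.castSucc s) = π' (Fin.castSucc s) := by
    intro s
    rcases Fin.eq_castSucc_or_eq_last (π (Fin.castSucc s)) with ⟨t, ht⟩ | hl
    · have hwt := hc.1 s t ht
      have hts : s ≠ t := fun h => by rw [h] at hwt; exact srev_ne_self _ hwt.symm
      rw [ht]; exact (hc'.2 s t hts (by rw [hwt]; rfl)).symm
    · rcases Fin.eq_castSucc_or_eq_last (π' (Fin.castSucc s)) with ⟨t', ht'⟩ | hl'
      · have hwt := hc'.1 s t' ht'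
        have hts : s ≠ t' := fun h => by rw [h] at hwt; exact srev_ne_self _ hwt.symm
        have := hc.2 s t' hts (by rw [hwt]; rfl)
        rw [hl] at this
        exact absurd this.symm (Fin.castSucc_lt_last t').ne
      · rw [hl, hl']
  funext x
  induction x using Fin.lastCases with
  | cast s => exact key s
  | last =>
    obtain ⟨l, hl⟩ := Fin.exists_castSucc_eq.2 (hd (Fin.last K)).2
    have h1 : π (Fin.castSucc l) = Fin.last K := by rw [hl, (hd _).1]
    rw [key l] at h1
    rw [← hl, ← h1, (hd' _).1]

open Classical in
/-- The diagram of a word (junk if none). [folklore] -/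
def diagOf (w : Fin K → Fin j × Bool) : Fin (K + 1) → Fin (K + 1) :=
  if h : ∃ π : Fin (K + 1) → Fin (K + 1), IsDiag π ∧ Compat π w then h.choose else id

/-- Every extremal full closing word is compatible with its diagram, which is irreducible. [folklore] -/
theorem diagOf_spec (hK : K + 1 = 2 * (k + 1)) {w : Fin K → Fin (k + 1) × Bool} (hw : w ∈ fullWords K k) :
    IsGood (diagOf w) ∧ Compat (diagOf w) w := by
  rw [mem_fullWords] at hw
  obtain ⟨hsaw, hl1, hax⟩ := hw
  have huse : ∀ c, 1 ≤ uses w c := fun c => by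
    obtain ⟨t, ht⟩ := hax c
    exact Finset.card_pos.2 ⟨t, Finset.mem_filter.2 ⟨Finset.mem_univ _, ht⟩⟩
  have hex := exists_isDiag_compat huse hl1 hK
  have h : IsDiag (diagOf w) ∧ Compat (diagOf w) w := by
    unfold diagOf
    rw [dif_pos hex]
    exact hex.choose_spec
  exact ⟨(isSAW_iff_isGood h.1 h.2).1 hsaw, h.2⟩

/-- **The count**: `#fullWords = #Irr · (k+1)! · 2^(k+1)`. [folklore] -/
theorem card_fullWords (hK : K + 1 = 2 * (k + 1)) :
    (fullWords K k).card = (goodSet (Fin (K + 1))).card * ((k + 1)! * 2 ^ (k + 1)) := by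
  classical
  rw [Finset.card_eq_sum_card_fiberwise (f := diagOf) (t := goodSet (Fin (K + 1)))
    (fun w hw => mem_goodSet.2 (diagOf_spec hK hw).1)]
  rw [← Finset.sum_const_nat (m := (k + 1)! * 2 ^ (k + 1)) (f := fun π => (fibre k π).card)
    (fun π hπ => card_fibre hK (mem_goodSet.1 hπ))]
  refine Finset.sum_congr rfl fun π hπ => ?_
  congr 1
  ext w
  unfold fibre
  rw [Finset.mem_filter, Finset.mem_filter]
  refine and_congr_right fun hw => ⟨fun h => h ▸ (diagOf_spec hK hw).2, fun h => ?_⟩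
  have hs := diagOf_spec hK hw
  exact compat_unique hs.1.1 (mem_goodSet.1 hπ).1 hs.2 h

/-- **`fullClosingCount (k+1) (2(k+1)) = (k+1)!·2^(k+1)·a(k+1)`**: the `2m`-gons of `ℤ^m` spanning all `m` axes are `m!·2^m` times the
connected chord diagrams with `m` chords. [folklore] -/
theorem fullClosingCount_eq (k : ℕ) : fullClosingCount (k + 1) (2 * (k + 1)) = (k + 1)! * 2 ^ (k + 1) * connChord (k + 1) := by
  rw [show 2 * (k + 1) = (2 * k + 1) + 1 by ring, fullClosingCount_eq_card, card_fullWords (by ring)]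
  have := card_goodSet_fin (k + 1) (by omega)
  rw [show 2 * (k + 1) = 2 * k + 1 + 1 by ring] at this
  rw [this]
  ring

end Summit.CriticalPhenomena.PercolationContinuityZ3.Theorems.Pcint.ChordDiag
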